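import Mathlib.Analysis.Calculus.LocalExtr.Basic
import Mathlib.Analysis.Calculus.Deriv.Comp
import Mathlib.Analysis.Calculus.Deriv.Add
import Mathlib.Analysis.Calculus.Deriv.Mul
import Summits.QuantumFields.YangMills.Theorems.UnitScaleTiltProp8FlatCriticalEquation143
import HarnessLib

/-!
# Route `UnitScaleTilt`, crux K1 child «MinimiserStabilityRegPr» (stmt-QuantumFields-19200), registered stub V2′ `stub_halvingStep` — pillar P5, the junction
# «MINIMUM ⇒ CRITICAL» in the chart: **a minimiser of a differentiable functional over (an affine constraint set ∩ an open ball) has vanishing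
# derivative along the constraint kernel** — the hypothesis `hcrit` of F4's `FlatCriticalEquation143.eq143_of_critical` ([Balaban1985Variational] (127) ⇒ (143)/(158))

Cell `ym3-torus` (HUMAN RULING D-0037, YM ladder rung R3 — continuum SU(2) YM₃ on the torus is a RUNG, not the Clay problem), width seat
`ym-ust-19200-w3` gen 0.  `--supports stmt-QuantumFields-19200 --as helper`; def-free, 0 sorry, standard axioms.

WHY (HALVING-SOCKET-w3g0.md §4(b), 19200 evidence #47).  In Sect. F the image `A′` of the localised minimiser `U′_k` is *«a minimum of 𝔊(A′)»* over the
configurations with the LINEAR constraints (157) `LʲηQ_jA′ = B` in the (152)-ball (p. 302), and print passes to the Euler–Lagrange equation (143)/(158)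
(*«thus representing it as A₁ + HB, we obtain Eq. (143) for A₁»*).  F4 (`FlatCriticalEquation143.eq143_of_critical`, p524450) starts from the CRITICALITY
shape `hcrit : ∀ δ, Qδ = 0 → ⟨δ, Δ_aA′ + w⟩ = 0`; this file supplies that shape from MINIMALITY by first-order calculus (the one-dimensional restriction
`t ↦ 𝔊(A′ + tδ)` has a local minimum at `0`, `IsLocalMin.hasDerivAt_eq_zero`), for any differentiable `𝔊` whose derivative at `A′` is represented by a
gradient through the dot product.

WHAT THIS FILE PROVES (generic; `E` a real normed space, resp. `ι → ℝ` with F4's dot-product letters):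
* §1 `hasDerivAt_line` (`t ↦ x + t•δ` has derivative `δ`), `isLocalMin_comp_line_of_isMinOn` (a minimum over a set containing the segment
  `{x + tδ : |t| < r}` restricts to a local minimum of `t ↦ f(x + tδ)` at `0`), **`fderiv_apply_eq_zero_of_isMinOn_segment`** (`f′(x) δ = 0`).
* §2 `segment_subset_affineBall` (for `Qδ = 0` the segment `|t| < ρ/(‖δ‖ + 1)` stays in `{X | QX = Qx} ∩ B(x, ρ)`),
  **`dot_grad_eq_zero_of_isMinOn_affineBall`** (`IsMinOn f {X | QX = Qx ∧ dist X x < ρ} x` ∧ `HasFDerivAt f f′ x` ∧ `f′ v = ⟨v, g⟩` ⇒ `⟨δ, g⟩ = 0` for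
  `Qδ = 0`), and **`hcrit_of_isMinOn_affineBall`** — the same with `g = Δ_a x + w`, i.e. EXACTLY the `hcrit` hypothesis of `eq143_of_critical`.
* §3 (v1.1, append-only) **`eq143_of_isMinOn_affineBall`** — minimality ⇒ (143)/(158) `x − H(Qx) = −G̃w` in one step (`FlatCriticalEquation143.eq143_of_critical` by name).

HONEST SCOPE: first-order calculus only; the identification of Sect. F's `𝔊` (the Wilson action through the chart (47)) and of its gradient with
`Δ_aA′ + W(A′)` ((81)/(142); P3b) is NOT done here.  No definition, no sorry, standard axioms.  NOT a claim about the crux, the rung, or the mass gap.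

References: T. Bałaban, CMP **102** (1985) 277–309 [Balaban1985Variational] (127)–(128) p.297, (143) p.300, (157)–(158) p.302.
-/

set_option autoImplicit false

noncomputable section

open scoped Matrix
open Filter Topology

namespace Summit.QuantumFields.YangMills.Theorems.FlatCriticalOfMin

/-! ## §1 A minimum over a set containing a segment ⇒ zero derivative along the segment -/

section Segment

variable {E : Type*} [NormedAddCommGroup E] [NormedSpace ℝ E]

/-- The line `t ↦ x + t•δ` has derivative `δ` (everywhere). [folklore] -/
theorem hasDerivAt_line (x δ : E) (t₀ : ℝ) : HasDerivAt (fun t : ℝ => x + t • δ) δ t₀ := by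
  have h := ((hasDerivAt_id t₀).smul_const δ).const_add x
  simpa using h

/-- If `x` minimises `f` over a set `S` containing the open segment `{x + tδ : |t| < r}` (`r > 0`), then `t ↦ f (x + tδ)` has a local minimum at `0`.
[cite: Balaban1985Variational, (127) p.297] -/
theorem isLocalMin_comp_line_of_isMinOn {f : E → ℝ} {S : Set E} {x δ : E} {r : ℝ} (hr : 0 < r)
    (hS : ∀ t : ℝ, |t| < r → x + t • δ ∈ S) (hmin : IsMinOn f S x) :
    IsLocalMin (fun t : ℝ => f (x + t • δ)) 0 := by
  have hball : Metric.ball (0 : ℝ) r ∈ 𝓝 (0 : ℝ) := Metric.ball_mem_nhds 0 hr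
  refine Filter.eventually_of_mem hball fun t ht => ?_
  have ht' : |t| < r := by simpa [Metric.mem_ball, Real.dist_eq] using ht
  have h := hmin (hS t ht')
  simpa using h

/-- **MINIMUM ⇒ ZERO DIRECTIONAL DERIVATIVE**: if `f` is differentiable at `x` with derivative `f′`, and `x` minimises `f` over a set containing the open
segment `{x + tδ : |t| < r}`, then `f′ δ = 0`. [cite: Balaban1985Variational, (127)–(128) p.297] -/
theorem fderiv_apply_eq_zero_of_isMinOn_segment {f : E → ℝ} {f' : E →L[ℝ] ℝ} {S : Set E} {x δ : E} {r : ℝ} (hr : 0 < r)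
    (hf : HasFDerivAt f f' x) (hS : ∀ t : ℝ, |t| < r → x + t • δ ∈ S) (hmin : IsMinOn f S x) : f' δ = 0 := by
  have hloc := isLocalMin_comp_line_of_isMinOn hr hS hmin
  have hx : x + (0 : ℝ) • δ = x := by simp
  have hf0 : HasFDerivAt f f' (x + (0 : ℝ) • δ) := by rw [hx]; exact hf
  have hline : HasDerivAt (fun t : ℝ => f (x + t • δ)) (f' δ) 0 :=
    hf0.comp_hasDerivAt (0 : ℝ) (hasDerivAt_line x δ 0)
  exact hloc.hasDerivAt_eq_zero hline

end Segment

/-! ## §2 The affine constraint set `{QX = Qx}` ∩ a ball: F4's `hcrit` from minimality -/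

section Affine

variable {ι κ : Type*} [Fintype ι]

/-- For `Qδ = 0` the segment `|t| < ρ/(‖δ‖ + 1)` through `x` stays in `{X | QX = Qx} ∩ B(x, ρ)`. [cite: Balaban1985Variational, (157) p.302] -/
theorem segment_subset_affineBall (Q : Matrix κ ι ℝ) (x δ : ι → ℝ) (hδ : Q *ᵥ δ = 0) (ρ : ℝ) :
    ∀ t : ℝ, |t| < ρ / (‖δ‖ + 1) → x + t • δ ∈ {X : ι → ℝ | Q *ᵥ X = Q *ᵥ x ∧ dist X x < ρ} := by
  intro t ht
  have hn : 0 < ‖δ‖ + 1 := by positivity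
  refine ⟨by rw [Matrix.mulVec_add, Matrix.mulVec_smul, hδ, smul_zero, add_zero], ?_⟩
  rw [dist_eq_norm, add_sub_cancel_left, norm_smul, Real.norm_eq_abs]
  have h1 : |t| * ‖δ‖ ≤ |t| * (‖δ‖ + 1) := mul_le_mul_of_nonneg_left (by linarith) (abs_nonneg t)
  have h2 : |t| * (‖δ‖ + 1) < ρ := by rwa [lt_div_iff₀ hn] at ht
  linarith

/-- **MINIMUM OVER `{QX = Qx} ∩ B(x, ρ)` ⇒ THE GRADIENT IS ORTHOGONAL TO `ker Q`**: if `x` minimises `f` over the affine-constraint ball, `f` has derivative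
`f′` at `x` represented by a gradient `g` (`f′ v = ⟨v, g⟩`), then `⟨δ, g⟩ = 0` for every `δ` with `Qδ = 0`. [cite: Balaban1985Variational, (127)–(128) p.297, (157) p.302] -/
theorem dot_grad_eq_zero_of_isMinOn_affineBall (Q : Matrix κ ι ℝ) {f : (ι → ℝ) → ℝ} {f' : (ι → ℝ) →L[ℝ] ℝ} {x : ι → ℝ} {ρ : ℝ}
    (hρ : 0 < ρ) (hf : HasFDerivAt f f' x) (hmin : IsMinOn f {X : ι → ℝ | Q *ᵥ X = Q *ᵥ x ∧ dist X x < ρ} x)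
    (g : ι → ℝ) (hgrad : ∀ v, f' v = v ⬝ᵥ g) :
    ∀ δ : ι → ℝ, Q *ᵥ δ = 0 → δ ⬝ᵥ g = 0 := by
  intro δ hδ
  have hr : 0 < ρ / (‖δ‖ + 1) := by positivity
  have h := fderiv_apply_eq_zero_of_isMinOn_segment hr hf (segment_subset_affineBall Q x δ hδ ρ) hmin
  rwa [hgrad] at h

/-- **F4's `hcrit` FROM MINIMALITY** ([Balaban1985Variational] (127) ⇒ the input of (143)/(158)): with the gradient written as `Δ_a x + w` (print: the
quadratic part `Δ₁A′` of (142) plus the current `w = J + (δ/δA′)V`), a minimiser over `{QX = Qx} ∩ B(x, ρ)` satisfies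
`∀ δ, Qδ = 0 → ⟨δ, Δ_a x + w⟩ = 0` — verbatim the hypothesis `hcrit` of `FlatCriticalEquation143.eq143_of_critical`. [cite: Balaban1985Variational, (127) p.297, (143) p.300, (158) p.302] -/
theorem hcrit_of_isMinOn_affineBall (Q : Matrix κ ι ℝ) (Δa : Matrix ι ι ℝ) {f : (ι → ℝ) → ℝ} {f' : (ι → ℝ) →L[ℝ] ℝ} {x : ι → ℝ}
    {ρ : ℝ} (hρ : 0 < ρ) (hf : HasFDerivAt f f' x) (hmin : IsMinOn f {X : ι → ℝ | Q *ᵥ X = Q *ᵥ x ∧ dist X x < ρ} x)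
    (w : ι → ℝ) (hgrad : ∀ v, f' v = v ⬝ᵥ (Δa *ᵥ x + w)) :
    ∀ δ : ι → ℝ, Q *ᵥ δ = 0 → δ ⬝ᵥ (Δa *ᵥ x + w) = 0 :=
  dot_grad_eq_zero_of_isMinOn_affineBall Q hρ hf hmin (Δa *ᵥ x + w) hgrad

end Affine

/-! ## §3 (v1.1, append-only) MINIMUM ⇒ (143)/(158) in one step (F4's `eq143_of_critical` by name) -/

section Eq143

variable {ι κ : Type*} [Fintype ι] [Fintype κ] [DecidableEq ι] [DecidableEq κ]

/-- **[Balaban1985Variational] (127) ⇒ (143)/(158) FROM MINIMALITY, BY NAME**: for `Δ_a` positive definite, `G = Δ_a⁻¹`, `K = QGQᵀ`,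
`G̃ = G − GQᵀK⁻¹QG`, a right inverse `H` of `Q` with `Δ_a`-orthogonal range, and a functional `f` differentiable at `x` with gradient `Δ_a x + w`:
if `x` MINIMISES `f` over `{X | QX = Qx} ∩ B(x, ρ)`, then `A₀ := x − H(Qx)` satisfies `QA₀ = 0` and `A₀ = −G̃w` — print's (143), at background 1
(158) «A₁ + G̃((δ/δA′)V)(A₁ + HB) = 0» (`§2` ∘ `FlatCriticalEquation143.eq143_of_critical`). [cite: Balaban1985Variational, (127) p.297, (143) p.300, (158) p.302] -/
theorem eq143_of_isMinOn_affineBall (Δa : Matrix ι ι ℝ) (Q : Matrix κ ι ℝ) (H : Matrix ι κ ℝ) (G : Matrix ι ι ℝ) (K : Matrix κ κ ℝ)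
    (Gt : Matrix ι ι ℝ) (hΔ : Δa.PosDef) (hG : G = Δa⁻¹) (hK : K = Q * G * Qᵀ) (hGt : Gt = G - G * Qᵀ * K⁻¹ * Q * G)
    (hQH : Q * H = 1) (hHorth : ∀ (δ : ι → ℝ), Q *ᵥ δ = 0 → ∀ B : κ → ℝ, δ ⬝ᵥ (Δa *ᵥ (H *ᵥ B)) = 0)
    {f : (ι → ℝ) → ℝ} {f' : (ι → ℝ) →L[ℝ] ℝ} {x : ι → ℝ} {ρ : ℝ} (hρ : 0 < ρ) (hf : HasFDerivAt f f' x)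
    (hmin : IsMinOn f {X : ι → ℝ | Q *ᵥ X = Q *ᵥ x ∧ dist X x < ρ} x)
    (w : ι → ℝ) (hgrad : ∀ v, f' v = v ⬝ᵥ (Δa *ᵥ x + w)) :
    Q *ᵥ (x - H *ᵥ (Q *ᵥ x)) = 0 ∧ x - H *ᵥ (Q *ᵥ x) = -(Gt *ᵥ w) :=
  FlatCriticalEquation143.eq143_of_critical (Δa := Δa) (Q := Q) (H := H) (G := G) (K := K) (Gt := Gt) hΔ hG hK hGt hQH hHorth x w
    (hcrit_of_isMinOn_affineBall Q Δa hρ hf hmin w hgrad)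

end Eq143

end Summit.QuantumFields.YangMills.Theorems.FlatCriticalOfMin

end
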